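/-
Origin: written from primary sources — A. Weil, Acta Math. 111 (1964) Chap. III n° 41, Lemme 5 p. 194 (majorants), Thm 6
p. 193 (`Θ_Φ(S)` depends continuously on `S`; invariance of `Θ` under rational points); R. Howe, *θ-series and invariant
theory* (1979) §3 and S. Kudla, *Seesaw dual reductive pairs* (1984) §1 (the see-saw restriction is the tensor of the small
representations up to a character). Adapted: no. This file DISCHARGES the majorant hypotheses `hM₃`/`hM₄` of the conjugated
`(34)` torus (`UnitaryDualPairSeesawThetaPeriod.seesawConjDatum₁/₂`) from Weil majorants of the big pair and of the two small
pairs, by a division argument on the see-saw identity of theta kernels (`UnitaryDualPairSeesawThetaProduct`). Kernel only;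
no records; nothing cited as a hypothesis.
-/
import Literature.NumberTheory.GelbartRogawski1991.UnitaryDualPairSeesawThetaProduct
import Literature.NumberTheory.Weil1964.AdelicThetaWitness
import Literature.NumberTheory.Weil1964.AdelicMetaplecticScalarTwist
import HarnessLib

/-!
# Weil majorants for the renormalised small pairs of the CONJUGATED `(34)` torus

Setting of `UnitaryDualPairSeesawThetaProduct` §2 / `UnitaryDualPairSeesawThetaPeriod` §3: three compatible splittings
`s, s₁, s₂` ([GelbartRogawski1991, Prop. 3.1.1] instances `IsCompatible`) of the unitary dual pairs `(U(J_V), U(J_W))`,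
`(U(J_V), U(J₁))`, `(U(J_V), U(J₂))`, a rational isometry `g = g₀ ⊗ 1 : (W, J₁ ⊕ᶠ J₂) ≅ (W, J_W)` moving the block-diagonal
torus to `g (U(J₁) × U(J₂)) g⁻¹ ⊂ U(J_W)`, Weil's rational lift `ω(r_F h₀)` of the see-saw element, and the renormalised small
representations `ω₁″ = seesawConjRep₁` (`ω ∘ pairSmall₁ s₁` twisted by `(v,u₁) ↦ λ_V′ v · λ₃ u₁`), `ω₂″ = seesawConjRep₂`
(`ω ∘ pairSmall₂ s₂` twisted by `λ₄`).

The sibling files record that the see-saw characters `λ_V′, λ₃, λ₄` of the conjugated torus carry NO continuity statement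
(`UnitaryDualPairSeesawContinuity`, `UnitaryDualPairSeesawConjCharacter`: conjugation by `ω(r_F h₀)` is not continuous for
the coefficient topology of `Mp_ψ(W_𝔸)ᶜᵒⁿᵗ`), which is why `UnitaryDualPairSeesawThetaPeriod` keeps Weil's majorants for
`ω₁″, ω₂″` as the HYPOTHESES `hM₃`, `hM₄` of `seesawConjDatum₁/₂`.  This file proves them, WITHOUT any continuity hypothesis
on the splittings, from the three majorant hypotheses the consumers already hold:

* §0 (abstract, any three homomorphisms `s, s₁, s₂` over the see-saw embedding, `Weil1964.AdelicMetaplecticSeesawCharacter`)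
  **`continuous_mpSeesawChar₃_of_theta`** — if the theta values `p ↦ Θ(ω(s p) Ψ)`, `q ↦ Θ(ω(s₁ q) Φ₁)`, `q ↦ Θ(ω(s₂ q) Φ₂)`
  are continuous for all test functions (Weil's Théorème 6, conjunct 1, for each of the three representations), then the
  see-saw character `χ` is continuous.  PROOF (division argument): by the see-saw identity of theta kernels
  `Θ(ω(s p) (Φ₁ ⊠ Φ₂)) = χ(p) · Θ(ω(s₁ ·) Φ₁) · Θ(ω(s₂ ·) Φ₂)` (`thetaDistLM_mpSeesaw_tensorToSum_eq_char_mul`); at a point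
  `p₀` choose `Φ_j := ω(s_j p₀⁻¹) W_j` with `Θ(W_j) ≠ 0` (`Weil1964.thetaDistLM_ne_zero`, the theta witness), so that the two
  small theta values do not vanish at `p₀`, hence on a neighbourhood, where `χ` is the quotient of two continuous functions;
  `continuous_mpCharV_of_theta`, `continuous_mpChar₁_of_theta`, `continuous_mpChar₂_of_theta` (the factors `λ_V, λ₁, λ₂`).
* §1 (the data of record) `UnitaryGroup.continuous_adelicIsometryConj` (`u ↦ g u g⁻¹` is continuous);
  `continuous_thetaDistLM_omega_seesawConjSum` — `p ↦ Θ(ω(seesawConjSum p) Ψ)` is continuous under Weil majorants `hρ` of the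
  big pair `ω ∘ s_pair` (read-back `thetaDistLM_omega_seesawConjSum`: `ω(r_F h₀)` fixes `Θ`, so the conjugation disappears
  under `Θ`); **`continuous_charV₃₄`**, **`continuous_char₃`**, **`continuous_char₄`**; and the two dischargers
  **`hasThetaMajorants_seesawConjRep₁`** (= `hM₃`), **`hasThetaMajorants_seesawConjRep₂`** (= `hM₄`) from
  `hρ : HasThetaMajorants (ω ∘ s_pair)` (the hypothesis of the big pair's `thetaKernelDatum`) and
  `hρ₁, hρ₂ : HasThetaMajorants (ω ∘ pairSmall_j s_j)` (the hypotheses of the `(12)` dischargers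
  `hasThetaMajorants_seesawRep₁/₂`), by `HasThetaMajorants.smul` [Weil1964, Lemme 5].

Provenance / use (Hodge-CM model-construction cell, row `real34`, BINDER-TRIAGE §52.3 (a)): PKG consumer = the `(34)` see-saw
inside `Real34FunBridge`'s `decomp` (`seesawConjPeriod_eq_thetaLift_mul`, «the same holds for type (34) with T′», PerL v5 tex
l. 326), which now needs no majorant hypothesis beyond `hρ, hρ₁, hρ₂`.  Nothing here is a claim of the manuscripts under
adjudication: kernel analysis over the tree's constructed objects.
-/

set_option autoImplicit false

noncomputable section

open scoped Matrix Kronecker Topology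
open Filter NumberField
open Literature.RepresentationTheory Literature.RepresentationTheory.SeesawScalar
open Literature.RepresentationTheory.HeisenbergGroup
open Literature.NumberTheory.Automorphic
open Literature.NumberTheory.Automorphic.UnitaryGroup
open Literature.NumberTheory.Weil1964

/-! ## §1a Continuity of conjugation by an adelic isometry -/

namespace Literature.NumberTheory.Automorphic

namespace UnitaryGroup

/-- **`u′ ↦ g u′ g⁻¹ : U(J_W′)(𝔸_F) → U(J_W)(𝔸_F)` is continuous** (multiplication in `GL_M(𝔸_E)` is continuous).
[folklore] -/
theorem continuous_adelicIsometryConj (F E : Type) [Field F] [Field E] [NumberField E] [Algebra F E] (c : E ≃ₐ[F] E)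
    (M : ℕ) {JW JW' : Matrix (Fin M) (Fin M) E} (g : GL (Fin M) (AdeleRing (𝓞 E) E))
    (hg : ((g : Matrix (Fin M) (Fin M) (AdeleRing (𝓞 E) E)).map (conjAdele F E c))ᵀ * adelicForm E M JW * g =
      adelicForm E M JW') :
    Continuous (adelicIsometryConj F E c M g hg) :=
  continuous_induced_rng.2 ((continuous_const.mul continuous_subtype_val).mul continuous_const)

end UnitaryGroup

end Literature.NumberTheory.Automorphic

namespace Literature.NumberTheory.GelbartRogawski1991

namespace UnitaryDualPair

/-! ## §0 Continuity of the see-saw character from continuity of theta values (abstract three homomorphisms) -/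

section Abstract

variable {F : Type} [Field F] [NumberField F]
variable {ι₁ ι₂ : Type} [Fintype ι₁] [DecidableEq ι₁] [Fintype ι₂] [DecidableEq ι₂]
variable {T₁ : Matrix ι₁ ι₁ (AdeleRing (𝓞 F) F)} {T₂ : Matrix ι₂ ι₂ (AdeleRing (𝓞 F) F)}
variable {GV U₁ U₂ : Type*} [Group GV] [Group U₁] [Group U₂]
  [TopologicalSpace GV] [TopologicalSpace U₁] [TopologicalSpace U₂]
  (s : GV × (U₁ × U₂) →* adelicMpCont F (ι₁ ⊕ ι₂) (Matrix.fromBlocks T₁ 0 0 T₂))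
  (s₁ : GV × U₁ →* adelicMpCont F ι₁ T₁) (s₂ : GV × U₂ →* adelicMpCont F ι₂ T₂)
  (hs : ∀ (g : GV) (u₁ : U₁) (u₂ : U₂),
    adelicMpCont.proj F (ι₁ ⊕ ι₂) (Matrix.fromBlocks T₁ 0 0 T₂) (s (g, (u₁, u₂))) =
      UnitaryGroup.spSum T₁ T₂
        (adelicMpCont.proj F ι₁ T₁ (s₁ (g, u₁)), adelicMpCont.proj F ι₂ T₂ (s₂ (g, u₂))))
  (hT₁ : IsUnit T₁) (hT₂ : IsUnit T₂)
  -- continuity of the theta values of the three representations ([Weil1964] Thm 6, conjunct 1)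
  (hΘ : ∀ Ψ : piSchwartzBruhat F (ι₁ ⊕ ι₂), Continuous fun p : GV × (U₁ × U₂) =>
    thetaDistLM F (ι₁ ⊕ ι₂) (adelicMpCont.omega F (ι₁ ⊕ ι₂) (Matrix.fromBlocks T₁ 0 0 T₂) (s p) Ψ))
  (hΘ₁ : ∀ Φ₁ : piSchwartzBruhat F ι₁, Continuous fun q : GV × U₁ =>
    thetaDistLM F ι₁ (adelicMpCont.omega F ι₁ T₁ (s₁ q) Φ₁))
  (hΘ₂ : ∀ Φ₂ : piSchwartzBruhat F ι₂, Continuous fun q : GV × U₂ =>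
    thetaDistLM F ι₂ (adelicMpCont.omega F ι₂ T₂ (s₂ q) Φ₂))

/-- `ω(σ g) (ω(σ g⁻¹) Φ) = Φ` for a homomorphism `σ` into `Mp_ψ(W_𝔸)ᶜᵒⁿᵗ`. [folklore] -/
theorem omega_apply_omega_inv_apply {ι : Type} [Fintype ι] [DecidableEq ι] {T : Matrix ι ι (AdeleRing (𝓞 F) F)}
    {G : Type*} [Group G] (σ : G →* adelicMpCont F ι T) (g : G) (Φ : piSchwartzBruhat F ι) :
    adelicMpCont.omega F ι T (σ g) (adelicMpCont.omega F ι T (σ g⁻¹) Φ) = Φ :=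
  (congrArg (fun x : adelicMpCont F ι T => adelicMpCont.omega F ι T (σ g) (adelicMpCont.omega F ι T x Φ))
      (map_inv σ g)).trans
    ((adelicMpCont.omega F ι T).self_inv_apply (σ g) Φ)

include hΘ hΘ₁ hΘ₂ in
/-- **Continuity of the see-saw character from continuity of the theta values** (division argument).  If
`p ↦ Θ(ω(s p) Ψ)`, `q ↦ Θ(ω(s₁ q) Φ₁)`, `q ↦ Θ(ω(s₂ q) Φ₂)` are continuous for all test functions ([Weil1964] Thm 6,
conjunct 1, for the three representations — e.g. from Weil majorants, `HasThetaMajorants.continuous_thetaDistLM`), then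
`χ : GV × (U₁ × U₂) → ℂ` is continuous: `Θ(ω(s p)(Φ₁ ⊠ Φ₂)) = χ(p) Θ(ω(s₁ ·)Φ₁) Θ(ω(s₂ ·)Φ₂)` and the two small theta
values can be made non-zero at any given point (theta witness). [cite: Weil1964, Chap. III n° 41 Thm 6 p. 193] -/
theorem continuous_mpSeesawChar₃_of_theta :
    Continuous fun p : GV × (U₁ × U₂) => (mpSeesawChar₃ s s₁ s₂ hs hT₁ hT₂ p : ℂ) := by
  refine continuous_iff_continuousAt.2 fun p₀ => ?_
  obtain ⟨g₀, u₁₀, u₂₀⟩ := p₀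
  -- test functions whose small theta values at `p₀` are the (non-zero) theta values of the theta witnesses
  obtain ⟨Φ₁, hΦ₁⟩ : ∃ Φ₁ : piSchwartzBruhat F ι₁,
      adelicMpCont.omega F ι₁ T₁ (s₁ (g₀, u₁₀)) Φ₁ = ⟨thetaWitness F ι₁, thetaWitness_mem F ι₁⟩ :=
    ⟨_, omega_apply_omega_inv_apply s₁ (g₀, u₁₀) _⟩
  obtain ⟨Φ₂, hΦ₂⟩ : ∃ Φ₂ : piSchwartzBruhat F ι₂,
      adelicMpCont.omega F ι₂ T₂ (s₂ (g₀, u₂₀)) Φ₂ = ⟨thetaWitness F ι₂, thetaWitness_mem F ι₂⟩ :=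
    ⟨_, omega_apply_omega_inv_apply s₂ (g₀, u₂₀) _⟩
  -- the denominator `D(p) = Θ(ω(s₁ (v,u₁)) Φ₁) · Θ(ω(s₂ (v,u₂)) Φ₂)` and the numerator `N(p) = Θ(ω(s p) (Φ₁ ⊠ Φ₂))`
  have hD : Continuous fun p : GV × (U₁ × U₂) =>
      thetaDistLM F ι₁ (adelicMpCont.omega F ι₁ T₁ (s₁ (p.1, p.2.1)) Φ₁) *
        thetaDistLM F ι₂ (adelicMpCont.omega F ι₂ T₂ (s₂ (p.1, p.2.2)) Φ₂) :=
    ((hΘ₁ Φ₁).comp (continuous_fst.prodMk (continuous_fst.comp continuous_snd))).mul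
      ((hΘ₂ Φ₂).comp (continuous_fst.prodMk (continuous_snd.comp continuous_snd)))
  have hD0 : thetaDistLM F ι₁ (adelicMpCont.omega F ι₁ T₁ (s₁ (g₀, u₁₀)) Φ₁) *
      thetaDistLM F ι₂ (adelicMpCont.omega F ι₂ T₂ (s₂ (g₀, u₂₀)) Φ₂) ≠ 0 :=
    (congrArg₂ (· * ·) (congrArg (thetaDistLM F ι₁) hΦ₁) (congrArg (thetaDistLM F ι₂) hΦ₂)).trans_ne
      (mul_ne_zero (thetaDistLM_thetaWitness_ne_zero F ι₁) (thetaDistLM_thetaWitness_ne_zero F ι₂))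
  have hN := hΘ (tensorToSum F ι₁ ι₂ Φ₁ Φ₂)
  -- the see-saw identity of theta kernels: `N = χ · D`
  have key : ∀ p : GV × (U₁ × U₂),
      thetaDistLM F (ι₁ ⊕ ι₂)
          (adelicMpCont.omega F (ι₁ ⊕ ι₂) (Matrix.fromBlocks T₁ 0 0 T₂) (s p) (tensorToSum F ι₁ ι₂ Φ₁ Φ₂)) =
        (mpSeesawChar₃ s s₁ s₂ hs hT₁ hT₂ p : ℂ) *
          (thetaDistLM F ι₁ (adelicMpCont.omega F ι₁ T₁ (s₁ (p.1, p.2.1)) Φ₁) *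
            thetaDistLM F ι₂ (adelicMpCont.omega F ι₂ T₂ (s₂ (p.1, p.2.2)) Φ₂)) :=
    fun p => thetaDistLM_mpSeesaw_tensorToSum_eq_char_mul s s₁ s₂ hs hT₁ hT₂ p.1 p.2.1 p.2.2 Φ₁ Φ₂
  -- on the neighbourhood `{D ≠ 0}` of `p₀`, `χ = N / D`
  have hχ : (fun p : GV × (U₁ × U₂) =>
        thetaDistLM F (ι₁ ⊕ ι₂)
            (adelicMpCont.omega F (ι₁ ⊕ ι₂) (Matrix.fromBlocks T₁ 0 0 T₂) (s p) (tensorToSum F ι₁ ι₂ Φ₁ Φ₂)) /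
          (thetaDistLM F ι₁ (adelicMpCont.omega F ι₁ T₁ (s₁ (p.1, p.2.1)) Φ₁) *
            thetaDistLM F ι₂ (adelicMpCont.omega F ι₂ T₂ (s₂ (p.1, p.2.2)) Φ₂))) =ᶠ[𝓝 (g₀, (u₁₀, u₂₀))]
      fun p => (mpSeesawChar₃ s s₁ s₂ hs hT₁ hT₂ p : ℂ) := by
    filter_upwards [hD.continuousAt.eventually_ne hD0] with p hp
    exact (div_eq_iff hp).2 (key p)
  have hq : ContinuousAt (fun p : GV × (U₁ × U₂) =>
      thetaDistLM F (ι₁ ⊕ ι₂)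
          (adelicMpCont.omega F (ι₁ ⊕ ι₂) (Matrix.fromBlocks T₁ 0 0 T₂) (s p) (tensorToSum F ι₁ ι₂ Φ₁ Φ₂)) /
        (thetaDistLM F ι₁ (adelicMpCont.omega F ι₁ T₁ (s₁ (p.1, p.2.1)) Φ₁) *
          thetaDistLM F ι₂ (adelicMpCont.omega F ι₂ T₂ (s₂ (p.1, p.2.2)) Φ₂))) (g₀, (u₁₀, u₂₀)) :=
    hN.continuousAt.div hD.continuousAt hD0
  exact hq.congr hχ

include hΘ hΘ₁ hΘ₂ in
/-- **`λ_V : GV → ℂ` is continuous** under the theta-continuity hypotheses of `continuous_mpSeesawChar₃_of_theta`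
(`λ_V g = χ(g,(1,1))`). [cite: Weil1964, Chap. III n° 41 Thm 6 p. 193] -/
theorem continuous_mpCharV_of_theta :
    Continuous fun g : GV => (mpCharV s s₁ s₂ hs hT₁ hT₂ g : ℂ) := by
  refine ((continuous_mpSeesawChar₃_of_theta s s₁ s₂ hs hT₁ hT₂ hΘ hΘ₁ hΘ₂).comp
    (continuous_id.prodMk (continuous_const (y := ((1 : U₁), (1 : U₂)))))).congr fun g => ?_
  simp only [Function.comp_apply, id_eq, mpSeesawChar₃_factor, map_one, mul_one]

include hΘ hΘ₁ hΘ₂ in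
/-- **`λ₁ : U₁ → ℂ` is continuous** under the same hypotheses (`λ₁ u₁ = χ(1,(u₁,1))`).
[cite: Weil1964, Chap. III n° 41 Thm 6 p. 193] -/
theorem continuous_mpChar₁_of_theta :
    Continuous fun u₁ : U₁ => (mpChar₁ s s₁ s₂ hs hT₁ hT₂ u₁ : ℂ) := by
  refine ((continuous_mpSeesawChar₃_of_theta s s₁ s₂ hs hT₁ hT₂ hΘ hΘ₁ hΘ₂).comp
    ((continuous_const (y := (1 : GV))).prodMk
      (continuous_id.prodMk (continuous_const (y := (1 : U₂)))))).congr fun u₁ => ?_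
  simp only [Function.comp_apply, id_eq, mpSeesawChar₃_factor, map_one, one_mul, mul_one]

include hΘ hΘ₁ hΘ₂ in
/-- **`λ₂ : U₂ → ℂ` is continuous** under the same hypotheses (`λ₂ u₂ = χ(1,(1,u₂))`).
[cite: Weil1964, Chap. III n° 41 Thm 6 p. 193] -/
theorem continuous_mpChar₂_of_theta :
    Continuous fun u₂ : U₂ => (mpChar₂ s s₁ s₂ hs hT₁ hT₂ u₂ : ℂ) := by
  refine ((continuous_mpSeesawChar₃_of_theta s s₁ s₂ hs hT₁ hT₂ hΘ hΘ₁ hΘ₂).comp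
    ((continuous_const (y := (1 : GV))).prodMk
      ((continuous_const (y := (1 : U₁))).prodMk continuous_id))).congr fun u₂ => ?_
  simp only [Function.comp_apply, id_eq, mpSeesawChar₃_factor, map_one, one_mul]

end Abstract

/-! ## §1 The conjugated `(34)` torus at the splitting data of record -/

section ThirtyFour

variable (F E : Type) [Field F] [NumberField F] [Field E] [NumberField E] [Algebra F E]
variable (c : E ≃ₐ[F] E) (N M₁ M₂ : ℕ) {n n₁ n₂ : ℕ} (eW : Fin N × Fin (M₁ + M₂) ≃ Fin n)
  (e₁ : Fin N × Fin M₁ ≃ Fin n₁) (e₂ : Fin N × Fin M₂ ≃ Fin n₂)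
variable (JV : Matrix (Fin N) (Fin N) E) (JW : Matrix (Fin (M₁ + M₂)) (Fin (M₁ + M₂)) E)
  (J₁ : Matrix (Fin M₁) (Fin M₁) E) (J₂ : Matrix (Fin M₂) (Fin M₂) E)
variable {TV : Matrix (Fin N) (Fin N) F} {TW : Matrix (Fin (M₁ + M₂)) (Fin (M₁ + M₂)) F}
  {T₁ : Matrix (Fin M₁) (Fin M₁) F} {T₂ : Matrix (Fin M₂) (Fin M₂) F}
variable [Algebra.IsQuadraticExtension F E] {δ : E} (hcδ : c δ = -δ) (hδ : δ ≠ 0) {d : F}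
  (hd : δ * δ = algebraMap F E d) (hV : TV.IsSymm) (hW : TW.IsSymm) (h₁ : T₁.IsSymm) (h₂ : T₂.IsSymm)
  (hVd : IsUnit TV.det) (hTWd : IsUnit TW.det) (h₁d : IsUnit T₁.det) (h₂d : IsUnit T₂.det)
  (hT : IsUnit (TV.map (algebraMap F (AdeleRing (𝓞 F) F)) ⊗ₖ TW.map (algebraMap F (AdeleRing (𝓞 F) F))).det)
  (hJV : JV = TV.map (algebraMap F E)) (hJW : JW = TW.map (algebraMap F E))
  (hJ₁ : J₁ = T₁.map (algebraMap F E)) (hJ₂ : J₂ = T₂.map (algebraMap F E))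
  {s : adelicPair F E c N (M₁ + M₂) JV JW →* adelicMpCont F (Fin n) (adelicGram F eW TV TW)}
  {s₁ : adelicPair F E c N M₁ JV J₁ →* adelicMpCont F (Fin n₁) (adelicGram F e₁ TV T₁)}
  {s₂ : adelicPair F E c N M₂ JV J₂ →* adelicMpCont F (Fin n₂) (adelicGram F e₂ TV T₂)}
  {g : GL (Fin (M₁ + M₂)) (AdeleRing (𝓞 E) E)} {g₀ : GL (Fin (M₁ + M₂)) E}
  (hgg₀ : (g : Matrix (Fin (M₁ + M₂)) (Fin (M₁ + M₂)) (AdeleRing (𝓞 E) E)) =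
    ((g₀ : GL (Fin (M₁ + M₂)) E) : Matrix (Fin (M₁ + M₂)) (Fin (M₁ + M₂)) E).map (algebraMap E (AdeleRing (𝓞 E) E)))
  (hg : ((g : Matrix (Fin (M₁ + M₂)) (Fin (M₁ + M₂)) (AdeleRing (𝓞 E) E)).map (conjAdele F E c))ᵀ *
      adelicForm E (M₁ + M₂) JW * g = adelicForm E (M₁ + M₂) (finSum M₁ M₂ J₁ J₂))
  {C : GL (Fin N × Fin (M₁ + M₂)) (AdeleRing (𝓞 F) F)} {C₀ : GL (Fin N × Fin (M₁ + M₂)) F}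
  (hCC₀ : (C : Matrix (Fin N × Fin (M₁ + M₂)) (Fin N × Fin (M₁ + M₂)) (AdeleRing (𝓞 F) F)) =
    ((C₀ : GL (Fin N × Fin (M₁ + M₂)) F) : Matrix (Fin N × Fin (M₁ + M₂)) (Fin N × Fin (M₁ + M₂)) F).map
      (algebraMap F (AdeleRing (𝓞 F) F)))
  (hC : TV.map (algebraMap F (AdeleRing (𝓞 F) F)) ⊗ₖ TW.map (algebraMap F (AdeleRing (𝓞 F) F)) *
      (C : Matrix (Fin N × Fin (M₁ + M₂)) (Fin N × Fin (M₁ + M₂)) (AdeleRing (𝓞 F) F)) =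
    TV.map (algebraMap F (AdeleRing (𝓞 F) F)) ⊗ₖ (finSum M₁ M₂ T₁ T₂).map (algebraMap F (AdeleRing (𝓞 F) F)))
  (hs : (splittingDatum F E c N (M₁ + M₂) eW JV JW hcδ hδ hd hV hW hVd hTWd hJV hJW).IsCompatible s)
  (hs₁ : (splittingDatum F E c N M₁ e₁ JV J₁ hcδ hδ hd hV h₁ hVd h₁d hJV hJ₁).IsCompatible s₁)
  (hs₂ : (splittingDatum F E c N M₂ e₂ JV J₂ hcδ hδ hd hV h₂ hVd h₂d hJV hJ₂).IsCompatible s₂)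

/-! Weil's majorant hypotheses for the big pair `ω ∘ s_pair` (the hypothesis of its `thetaKernelDatum`) and for the two small
pairs `ω ∘ pairSmall_j s_j` (the hypotheses of the `(12)` dischargers `hasThetaMajorants_seesawRep₁/₂`). -/
variable
  (hρ : HasThetaMajorants fun (p : adelic F E c N JV × adelic F E c (M₁ + M₂) JW) (Φ : piSchwartzBruhat F (Fin n)) =>
    pairRep F E c N (M₁ + M₂) eW JV JW s p Φ)
  (hρ₁ : HasThetaMajorants fun (p : adelic F E c N JV × adelic F E c M₁ J₁) (Φ : piSchwartzBruhat F (Fin N × Fin M₁)) =>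
    (adelicMpCont.omega F (Fin N × Fin M₁)
      (TV.map (algebraMap F (AdeleRing (𝓞 F) F)) ⊗ₖ T₁.map (algebraMap F (AdeleRing (𝓞 F) F))))
      (pairSmall₁ F E c N M₁ e₁ JV J₁ s₁ p) Φ)
  (hρ₂ : HasThetaMajorants fun (p : adelic F E c N JV × adelic F E c M₂ J₂) (Φ : piSchwartzBruhat F (Fin N × Fin M₂)) =>
    (adelicMpCont.omega F (Fin N × Fin M₂)
      (TV.map (algebraMap F (AdeleRing (𝓞 F) F)) ⊗ₖ T₂.map (algebraMap F (AdeleRing (𝓞 F) F))))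
      (pairSmall₂ F E c N M₂ e₂ JV J₂ s₂ p) Φ)

include hρ in
/-- **the theta values of the conjugated block-sum splitting are continuous** under Weil majorants of the big pair:
`p ↦ Θ(ω(seesawConjSum p) Ψ) = Θ(ω_ψ(s_pair(v, g (u₁ ⊕ᶠ u₂) g⁻¹)) Ψ′)` (`ω(r_F h₀)` fixes `Θ`, `thetaDistLM_omega_seesawConjSum`)
is continuous in `p = (v,(u₁,u₂))` ([Weil1964] Thm 6 conjunct 1 for `ω ∘ s_pair`, `HasThetaMajorants.continuous_thetaDistLM`).
[cite: Weil1964, Chap. III n° 41 Thm 6 p. 193] -/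
theorem continuous_thetaDistLM_omega_seesawConjSum (Ψ : piSchwartzBruhat F ((Fin N × Fin M₁) ⊕ (Fin N × Fin M₂))) :
    Continuous fun p : adelic F E c N JV × (adelic F E c M₁ J₁ × adelic F E c M₂ J₂) =>
      thetaDistLM F ((Fin N × Fin M₁) ⊕ (Fin N × Fin M₂))
        (adelicMpCont.omega F ((Fin N × Fin M₁) ⊕ (Fin N × Fin M₂))
          (Matrix.fromBlocks (TV.map (algebraMap F (AdeleRing (𝓞 F) F)) ⊗ₖ T₁.map (algebraMap F (AdeleRing (𝓞 F) F))) 0 0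
            (TV.map (algebraMap F (AdeleRing (𝓞 F) F)) ⊗ₖ T₂.map (algebraMap F (AdeleRing (𝓞 F) F))))
          (seesawConjSum F E c N M₁ M₂ eW JV JW J₁ J₂ hcδ hδ hd hV hW h₁ h₂ hVd hTWd hT hJV hJW hJ₁ hJ₂ hgg₀ hg hCC₀ hC
            (s := s) p) Ψ) := by
  refine ((hρ.continuous_thetaDistLM
    (piSBReindex F eW
      (adelicMpCont.omega F (Fin N × Fin (M₁ + M₂))
        (TV.map (algebraMap F (AdeleRing (𝓞 F) F)) ⊗ₖ TW.map (algebraMap F (AdeleRing (𝓞 F) F)))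
        (ratPointsThetaLiftCont F (Fin N × Fin (M₁ + M₂)) _ hT
          ⟨seesawElement F E c N M₁ M₂ JV JW J₁ J₂ hcδ hδ hd hV hW h₁ h₂ hJV hJW hJ₁ hJ₂ hg hC,
            seesawElement_mem_range F E c N M₁ M₂ JV JW J₁ J₂ hcδ hδ hd hV hW h₁ h₂ hVd hTWd hT hJV hJW hJ₁ hJ₂ hgg₀
              hg hCC₀ hC⟩)
        ((piSBReindex F (finProdSumEquiv N M₁ M₂)).symm Ψ)))).comp
    (continuous_fst.prodMk ((continuous_adelicIsometryConj F E c (M₁ + M₂) g hg).comp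
      ((continuous_adelicBlockDiag F E c M₁ M₂ J₁ J₂).comp continuous_snd)))).congr fun p => ?_
  simp only [Function.comp_apply, pairRep_apply]
  exact (thetaDistLM_omega_seesawConjSum F E c N M₁ M₂ eW JV JW J₁ J₂ hcδ hδ hd hV hW h₁ h₂ hVd hTWd hT hJV hJW hJ₁ hJ₂
    hgg₀ hg hCC₀ hC (s := s) p Ψ).symm

include hρ hρ₁ hρ₂ in
/-- **`λ_V′` is continuous** — from Weil majorants of the big pair and of the two small pairs (no continuity of any splitting
is used). [cite: Weil1964, Chap. III n° 41 Thm 6 p. 193] -/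
theorem continuous_charV₃₄ :
    Continuous fun v : adelic F E c N JV =>
      (charV₃₄ F E c N M₁ M₂ eW e₁ e₂ JV JW J₁ J₂ hcδ hδ hd hV hW h₁ h₂ hVd hTWd h₁d h₂d hT hJV hJW hJ₁ hJ₂ hgg₀ hg hCC₀ hC
        hs hs₁ hs₂ v : ℂ) :=
  continuous_mpCharV_of_theta _ _ _
    (hs₃_seesawConj F E c N M₁ M₂ eW e₁ e₂ JV JW J₁ J₂ hcδ hδ hd hV hW h₁ h₂ hVd hTWd h₁d h₂d hT hJV hJW hJ₁ hJ₂ hgg₀ hg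
      hCC₀ hC hs hs₁ hs₂) _ _
    (continuous_thetaDistLM_omega_seesawConjSum F E c N M₁ M₂ eW JV JW J₁ J₂ hcδ hδ hd hV hW h₁ h₂ hVd hTWd hT hJV hJW
      hJ₁ hJ₂ hgg₀ hg hCC₀ hC hρ)
    hρ₁.continuous_thetaDistLM hρ₂.continuous_thetaDistLM

include hρ hρ₁ hρ₂ in
/-- **`λ₃` is continuous** (same hypotheses). [cite: Weil1964, Chap. III n° 41 Thm 6 p. 193] -/
theorem continuous_char₃ :
    Continuous fun u₁ : adelic F E c M₁ J₁ =>
      (char₃ F E c N M₁ M₂ eW e₁ e₂ JV JW J₁ J₂ hcδ hδ hd hV hW h₁ h₂ hVd hTWd h₁d h₂d hT hJV hJW hJ₁ hJ₂ hgg₀ hg hCC₀ hC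
        hs hs₁ hs₂ u₁ : ℂ) :=
  continuous_mpChar₁_of_theta _ _ _
    (hs₃_seesawConj F E c N M₁ M₂ eW e₁ e₂ JV JW J₁ J₂ hcδ hδ hd hV hW h₁ h₂ hVd hTWd h₁d h₂d hT hJV hJW hJ₁ hJ₂ hgg₀ hg
      hCC₀ hC hs hs₁ hs₂) _ _
    (continuous_thetaDistLM_omega_seesawConjSum F E c N M₁ M₂ eW JV JW J₁ J₂ hcδ hδ hd hV hW h₁ h₂ hVd hTWd hT hJV hJW
      hJ₁ hJ₂ hgg₀ hg hCC₀ hC hρ)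
    hρ₁.continuous_thetaDistLM hρ₂.continuous_thetaDistLM

include hρ hρ₁ hρ₂ in
/-- **`λ₄` is continuous** (same hypotheses). [cite: Weil1964, Chap. III n° 41 Thm 6 p. 193] -/
theorem continuous_char₄ :
    Continuous fun u₂ : adelic F E c M₂ J₂ =>
      (char₄ F E c N M₁ M₂ eW e₁ e₂ JV JW J₁ J₂ hcδ hδ hd hV hW h₁ h₂ hVd hTWd h₁d h₂d hT hJV hJW hJ₁ hJ₂ hgg₀ hg hCC₀ hC
        hs hs₁ hs₂ u₂ : ℂ) :=
  continuous_mpChar₂_of_theta _ _ _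
    (hs₃_seesawConj F E c N M₁ M₂ eW e₁ e₂ JV JW J₁ J₂ hcδ hδ hd hV hW h₁ h₂ hVd hTWd h₁d h₂d hT hJV hJW hJ₁ hJ₂ hgg₀ hg
      hCC₀ hC hs hs₁ hs₂) _ _
    (continuous_thetaDistLM_omega_seesawConjSum F E c N M₁ M₂ eW JV JW J₁ J₂ hcδ hδ hd hV hW h₁ h₂ hVd hTWd hT hJV hJW
      hJ₁ hJ₂ hgg₀ hg hCC₀ hC hρ)
    hρ₁.continuous_thetaDistLM hρ₂.continuous_thetaDistLM

include hρ hρ₁ hρ₂ in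
/-- **`hM₃` DISCHARGED — Weil majorants for `ω₁″ = seesawConjRep₁`** (the majorant hypothesis of
`UnitaryDualPairSeesawThetaPeriod.seesawConjDatum₁`), from majorants of `ω ∘ s_pair` (big pair), `ω ∘ pairSmall₁ s₁`,
`ω ∘ pairSmall₂ s₂`: the see-saw character `λ_V′ λ₃` is continuous (`continuous_charV₃₄`, `continuous_char₃`), and a continuous
scalar twist preserves majorants. [cite: Weil1964, Chap. III n° 41 Lemme 5 p. 194] -/
theorem hasThetaMajorants_seesawConjRep₁ :
    HasThetaMajorants fun (p : adelic F E c N JV × adelic F E c M₁ J₁) (Φ : piSchwartzBruhat F (Fin N × Fin M₁)) =>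
      seesawConjRep₁ F E c N M₁ M₂ eW e₁ e₂ JV JW J₁ J₂ hcδ hδ hd hV hW h₁ h₂ hVd hTWd h₁d h₂d hT hJV hJW hJ₁ hJ₂ hgg₀ hg hCC₀
        hC hs hs₁ hs₂ p Φ := by
  have hcont : Continuous fun p : adelic F E c N JV × adelic F E c M₁ J₁ =>
      ((charV₃₄ F E c N M₁ M₂ eW e₁ e₂ JV JW J₁ J₂ hcδ hδ hd hV hW h₁ h₂ hVd hTWd h₁d h₂d hT hJV hJW hJ₁ hJ₂ hgg₀ hg hCC₀
            hC hs hs₁ hs₂ p.1 *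
          char₃ F E c N M₁ M₂ eW e₁ e₂ JV JW J₁ J₂ hcδ hδ hd hV hW h₁ h₂ hVd hTWd h₁d h₂d hT hJV hJW hJ₁ hJ₂ hgg₀ hg hCC₀ hC
            hs hs₁ hs₂ p.2 : ℂˣ) : ℂ) := by
    simp only [Units.val_mul]
    exact ((continuous_charV₃₄ F E c N M₁ M₂ eW e₁ e₂ JV JW J₁ J₂ hcδ hδ hd hV hW h₁ h₂ hVd hTWd h₁d h₂d hT hJV hJW hJ₁
        hJ₂ hgg₀ hg hCC₀ hC hs hs₁ hs₂ hρ hρ₁ hρ₂).comp continuous_fst).mul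
      ((continuous_char₃ F E c N M₁ M₂ eW e₁ e₂ JV JW J₁ J₂ hcδ hδ hd hV hW h₁ h₂ hVd hTWd h₁d h₂d hT hJV hJW hJ₁ hJ₂
        hgg₀ hg hCC₀ hC hs hs₁ hs₂ hρ hρ₁ hρ₂).comp continuous_snd)
  have hmaj := hρ₁.smul hcont
  refine ⟨fun Φ ξ => ?_, fun Φ g₁ => ?_⟩
  · refine (hmaj.continuous_eval Φ ξ).congr fun p => ?_
    exact congrArg (fun Ψ : piSchwartzBruhat F (Fin N × Fin M₁) => (Ψ : (Fin N × Fin M₁ → AdeleRing (𝓞 F) F) → ℂ)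
      (ratPt F (Fin N × Fin M₁) ξ))
      (seesawConjRep₁_apply F E c N M₁ M₂ eW e₁ e₂ JV JW J₁ J₂ hcδ hδ hd hV hW h₁ h₂ hVd hTWd h₁d h₂d hT hJV hJW hJ₁ hJ₂
        hgg₀ hg hCC₀ hC hs hs₁ hs₂ p.1 p.2 Φ).symm
  · obtain ⟨V, hVn, u, hu, hle⟩ := hmaj.exists_majorant Φ g₁
    refine ⟨V, hVn, u, hu, fun ξ p hp => ?_⟩
    rw [seesawConjRep₁_apply F E c N M₁ M₂ eW e₁ e₂ JV JW J₁ J₂ hcδ hδ hd hV hW h₁ h₂ hVd hTWd h₁d h₂d hT hJV hJW hJ₁ hJ₂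
      hgg₀ hg hCC₀ hC hs hs₁ hs₂ p.1 p.2 Φ]
    exact hle ξ p hp

include hρ hρ₁ hρ₂ in
/-- **`hM₄` DISCHARGED — Weil majorants for `ω₂″ = seesawConjRep₂`** (the majorant hypothesis of
`UnitaryDualPairSeesawThetaPeriod.seesawConjDatum₂`), from the same three majorant hypotheses (`λ₄` is continuous,
`continuous_char₄`). [cite: Weil1964, Chap. III n° 41 Lemme 5 p. 194] -/
theorem hasThetaMajorants_seesawConjRep₂ :
    HasThetaMajorants fun (p : adelic F E c N JV × adelic F E c M₂ J₂) (Φ : piSchwartzBruhat F (Fin N × Fin M₂)) =>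
      seesawConjRep₂ F E c N M₁ M₂ eW e₁ e₂ JV JW J₁ J₂ hcδ hδ hd hV hW h₁ h₂ hVd hTWd h₁d h₂d hT hJV hJW hJ₁ hJ₂ hgg₀ hg hCC₀
        hC hs hs₁ hs₂ p Φ := by
  have hcont : Continuous fun p : adelic F E c N JV × adelic F E c M₂ J₂ =>
      ((char₄ F E c N M₁ M₂ eW e₁ e₂ JV JW J₁ J₂ hcδ hδ hd hV hW h₁ h₂ hVd hTWd h₁d h₂d hT hJV hJW hJ₁ hJ₂ hgg₀ hg hCC₀ hC
          hs hs₁ hs₂ p.2 : ℂˣ) : ℂ) :=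
    (continuous_char₄ F E c N M₁ M₂ eW e₁ e₂ JV JW J₁ J₂ hcδ hδ hd hV hW h₁ h₂ hVd hTWd h₁d h₂d hT hJV hJW hJ₁ hJ₂ hgg₀ hg
      hCC₀ hC hs hs₁ hs₂ hρ hρ₁ hρ₂).comp continuous_snd
  have hmaj := hρ₂.smul hcont
  refine ⟨fun Φ ξ => ?_, fun Φ g₁ => ?_⟩
  · refine (hmaj.continuous_eval Φ ξ).congr fun p => ?_
    exact congrArg (fun Ψ : piSchwartzBruhat F (Fin N × Fin M₂) => (Ψ : (Fin N × Fin M₂ → AdeleRing (𝓞 F) F) → ℂ)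
      (ratPt F (Fin N × Fin M₂) ξ))
      (seesawConjRep₂_apply F E c N M₁ M₂ eW e₁ e₂ JV JW J₁ J₂ hcδ hδ hd hV hW h₁ h₂ hVd hTWd h₁d h₂d hT hJV hJW hJ₁ hJ₂
        hgg₀ hg hCC₀ hC hs hs₁ hs₂ p.1 p.2 Φ).symm
  · obtain ⟨V, hVn, u, hu, hle⟩ := hmaj.exists_majorant Φ g₁
    refine ⟨V, hVn, u, hu, fun ξ p hp => ?_⟩
    rw [seesawConjRep₂_apply F E c N M₁ M₂ eW e₁ e₂ JV JW J₁ J₂ hcδ hδ hd hV hW h₁ h₂ hVd hTWd h₁d h₂d hT hJV hJW hJ₁ hJ₂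
      hgg₀ hg hCC₀ hC hs hs₁ hs₂ p.1 p.2 Φ]
    exact hle ξ p hp

end ThirtyFour

end UnitaryDualPair

end Literature.NumberTheory.GelbartRogawski1991

end

/-! ### Build-lane note (ops-buildfix G11b-3 recipe v2, LEDGER B13-1/B14-5/B14-7, 2026-08-22)
`lean -o` (the hub build lane, never `lean`/the gate check) runs Lean 4.32's library-suggestion indexers
(`Lean.LibrarySuggestions.SymbolFrequency` / `SineQuaNon`, from their `exportEntriesFn`) over the statement of every local
theorem constant that is not a denied premise; on this family's statements (very large dependent binder telescopes) that fold
runs for tens of minutes (incident G11b-3, run/shared/lean/ops/buildfix/G11b-3-DOSSIER.md). `isDeniedPremise` skips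
`[implicit_reducible]` constants before any fold, and the status is inert on theorems (Meta never unfolds `thmInfo`).
v2 form: ONE file-final, top-level `local` attribute — it goes through the synchronous scoped reducibility extension that
`getReducibilityStatusCore` reads first, so it needs no `set_option Elab.async false` (parallel elaboration stays on), also
reaches auto-realized `*.congr_simp` / structure-projection theorem constants, is never popped before export, and is not
exported. No statement or proof is changed. -/
set_option allowUnsafeReducibility true in
attribute [local implicit_reducible]
  Literature.NumberTheory.Automorphic.UnitaryGroup.continuous_adelicIsometryConj
  Literature.NumberTheory.GelbartRogawski1991.UnitaryDualPair.omega_apply_omega_inv_apply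
  Literature.NumberTheory.GelbartRogawski1991.UnitaryDualPair.continuous_mpSeesawChar₃_of_theta
  Literature.NumberTheory.GelbartRogawski1991.UnitaryDualPair.continuous_mpCharV_of_theta
  Literature.NumberTheory.GelbartRogawski1991.UnitaryDualPair.continuous_mpChar₁_of_theta
  Literature.NumberTheory.GelbartRogawski1991.UnitaryDualPair.continuous_mpChar₂_of_theta
  Literature.NumberTheory.GelbartRogawski1991.UnitaryDualPair.continuous_thetaDistLM_omega_seesawConjSum
  Literature.NumberTheory.GelbartRogawski1991.UnitaryDualPair.continuous_charV₃₄
  Literature.NumberTheory.GelbartRogawski1991.UnitaryDualPair.continuous_char₃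
  Literature.NumberTheory.GelbartRogawski1991.UnitaryDualPair.continuous_char₄
  Literature.NumberTheory.GelbartRogawski1991.UnitaryDualPair.hasThetaMajorants_seesawConjRep₁
  Literature.NumberTheory.GelbartRogawski1991.UnitaryDualPair.hasThetaMajorants_seesawConjRep₂
  Literature.NumberTheory.GelbartRogawski1991.UnitaryDualPair.seesawElement.congr_simp
  Literature.NumberTheory.GelbartRogawski1991.UnitaryDualPair.charV₃₄.congr_simp
  Literature.NumberTheory.Automorphic.UnitaryGroup.adelicIsometryConj.congr_simp
  Literature.NumberTheory.Weil1964.mpSeesawChar₃.congr_simp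
  Literature.NumberTheory.Weil1964.mpChar₂.congr_simp
  Literature.NumberTheory.Weil1964.mpChar₁.congr_simp
  Literature.NumberTheory.Weil1964.mpCharV.congr_simp
  Literature.NumberTheory.GelbartRogawski1991.UnitaryDualPair.char₃.congr_simp
  Literature.NumberTheory.GelbartRogawski1991.UnitaryDualPair.seesawConjSum.congr_simp
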